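import Literature.Topology.FourManifolds.SeifertDiscUnknot
import Literature.Topology.FourManifolds.KnotOfClosedCurve
import Literature.Topology.FourManifolds.IsotopyExtension
import Literature.Topology.FourManifolds.IsotopyProofs
import Mathlib.Analysis.SpecialFunctions.SmoothTransition
import HarnessLib

/-!
# A knot bounding a smoothly embedded disc is trivial

Topic `Literature/Topology/FourManifolds` (fact seat
`provefact-Literature.Topology.FourManifolds.isUnkn-28b9dc4cf4`: Property R,
`Literature.Topology.FourManifolds.isUnknot_of_isIntegralSurgery_zero`, Gabai (1987) Cor. 8.3). The
gen-1 reduction `Literature.Topology.FourManifolds.isUnknot_of_isIntegralSurgery_zero_of_gabai_of_hirsch`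
(`SeifertDiscUnknot.lean`) rested on three named facts: Gabai's Corollary 8.3 (genus clause),
the classification of the disc (`diffeomorph_closedBall_of_genus_zero`) and Hirsch's disc
theorem in `𝕊³` (`exists_ambientIsotopy_of_smoothDisc_sphereThree`, Hirsch (1976), Ch. 8,
Thm. 3.1 for `k = 2`, `n = 3`). This file **proves** the consequence of the third fact that
Property R actually uses — *a knot bounding a smoothly embedded disc is the unknot*
(`Literature.Topology.FourManifolds.Knot.isUnknot_of_smoothDisc`) — and thereby reduces
Property R to the first two facts
(`Literature.Topology.FourManifolds.isUnknot_of_isIntegralSurgery_zero_of_gabai_of_classification`).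
Everything in this file is proved; no named fact is introduced.

## The argument

The isotopy extension theorem is proved in the tree for *boundaryless* compact sources
(`Literature.Topology.FourManifolds.isAmbientIsotopic_of_isSmoothlyIsotopic_of_boundaryless`,
`IsotopyExtension.lean`: Milnor (1965), Thm. 5.8; Hirsch (1976), Ch. 8, Thm. 1.3), so instead of
isotoping the disc `𝔻²` (which has boundary) we isotope its *boundary circle* through smooth
embeddings `𝕊¹ → 𝕊³`, following Hirsch's printed proof of the disc theorem (Ch. 8, Thm. 3.1,
pp. 185–186: radial isotopy into a chart, linearisation, path of linear maps) one dimension down: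

1. `isSmoothEmbedding_circle_of_injective` — an injective immersion `𝕊¹ → 𝕊³` is a smooth
   embedding in Mathlib's chart sense (`KnotOfClosedCurve.lean`: normal framing and tube), so a
   jointly smooth family of injective immersions of the circle is a `SmoothIsotopy`
   (`SmoothIsotopy.ofCircleFamily`).
2. `SmoothIsotopy.discCircle` — the round circles `u ↦ f (γ t + ρ t u)` inside a smooth disc
   `f : 𝔻² → 𝕊³` form a smooth isotopy (calculus into the manifold with boundary `𝔻²`,
   `ClosedBallSmoothMaps.lean`); this shrinks the boundary `K = f|∂𝔻²` to a small circle about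
   an interior point `c` (`isSmoothlyIsotopic_boundary_smallCircle`).
3. `exists_ball_injOn_straightLine` — **linearisation**: if `E` is `C^∞` near `0` with injective
   differential `A = DE(0)`, the straight-line maps `(1 - s) E + s (E 0 + A)`, `s ∈ [0, 1]`, are
   injective with injective differential on a small ball (mean value inequality against the
   lower bound of `A`); read in the stereographic chart of `𝕊³` at `p₀` this isotopes the small
   circle to a linear circle `σ⁻¹ (q + r A u)` and then to `σ⁻¹ (r A u)`
   (`exists_isSmoothlyIsotopic_straightLine`, `isSmoothlyIsotopic_translate`,
   `exists_isSmoothlyIsotopic_disc_linear`).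
4. `isSmoothlyIsotopic_linear` — any two linear circles `σ⁻¹ ∘ B|𝕊¹`, `B : ℝ² → ℝ³` injective,
   are smoothly isotopic: four rank-one moves of the columns (`colMap (u + s p) v` stays
   injective when `p ∉ span {u, v}`), the intermediate columns chosen outside three proper
   subspaces of `ℝ³` (`exists_not_mem_three`; no orientation condition in codimension `≥ 1`).
5. `Knot.isUnknot_of_smoothDisc` — chain `K ~ σ⁻¹B ~ σ⁻¹B₀ ~ unknot` (the unknot bounds the
   hemispherical disc, `Knot.exists_smoothDisc_unknot`) and apply isotopy extension; also the
   unconditional characterisation `Knot.isUnknot_iff_exists_smoothDisc`.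

## Main results

* `Literature.Topology.FourManifolds.Knot.isUnknot_of_smoothDisc`,
  `Literature.Topology.FourManifolds.Knot.isUnknot_iff_exists_smoothDisc` (proved).
* `Literature.Topology.FourManifolds.Knot.isUnknot_of_hasSeifertSurfaceOfGenus_zero_of_classification`:
  the named fact `Knot.isUnknot_of_hasSeifertSurfaceOfGenus_zero` (`SeifertGenusZero.lean`) from
  `diffeomorph_closedBall_of_genus_zero` alone.
* `Literature.Topology.FourManifolds.isUnknot_of_isIntegralSurgery_zero_of_gabai_of_classification`:
  Property R from Gabai (1987), Cor. 8.3 (genus clause) and the classification of the disc.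

## References

* M. W. Hirsch, *Differential Topology*, GTM 33, Springer (1976), Ch. 8 §1 Thm. 1.3 (isotopy
  extension), Ch. 8 §3 Thm. 3.1 and its proof, pp. 185–186 (disc theorem), Ch. 1 §3 Thm. 3.1
  (injective immersions of compact manifolds). [HirschDT1976]
* J. Milnor, *Lectures on the h-cobordism theorem* (1965), Thm. 5.8. [MilnorHCobordism1965]
* P. R. Cromwell, *Knots and Links*, Cambridge (2004), Ch. 5, p. 103 (a knot spanned by a disc
  is trivial). [Cromwell2004]
* D. Gabai, *Foliations and the topology of 3-manifolds. III*, J. Differential Geom. 26 (1987)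
  479–536, Cor. 8.3 (p. 525), Remark 8.5 (p. 526). [GabaiJDG1987]
-/

open scoped Manifold ContDiff Topology
open Function Set Metric Module

noncomputable section

namespace Literature.Topology.FourManifolds

/-- Local notation: `𝔼 n` is the model Euclidean space `EuclideanSpace ℝ (Fin n)`. -/
local notation "𝔼 " n:arg => EuclideanSpace ℝ (Fin n)

/-- Local notation: `𝕊 n` is the unit sphere in `EuclideanSpace ℝ (Fin (n + 1))`. -/
local notation "𝕊 " n:arg => (Metric.sphere (0 : EuclideanSpace ℝ (Fin (n + 1))) 1)

/-- Local notation: `𝔻 n` is the closed unit ball in `EuclideanSpace ℝ (Fin n)`. -/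
local notation "𝔻 " n:arg => (Metric.closedBall (0 : EuclideanSpace ℝ (Fin n)) 1)

attribute [local instance] fact_finrank_euclideanSpace_two fact_finrank_euclideanSpace_four

/-! ## Injective immersions of the circle into `𝕊³` are smooth embeddings -/

section CircleCriterion

/-- **An injective immersion of the circle into the `3`-sphere is a smooth embedding** in
Mathlib's chart sense (`Manifold.IsSmoothEmbedding`): the composite `γ = k ∘ circlePoint` is a
regular simple closed curve on `S³`, and `k` is the knot it defines
(`IsRegularClosedCurve.isSmoothEmbedding_toSphereMap`, normal framing and tube of
`KnotOfClosedCurve.lean`). Hirsch (1976), Ch. 1 §3, Thm. 3.1 (an injective immersion of a compact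
manifold is an embedding). [folklore] -/
theorem isSmoothEmbedding_circle_of_injective {k : (𝕊 1) → 𝕊 3}
    (hk : ContMDiff (𝓡 1) (𝓡 3) ∞ k) (hinj : Injective k)
    (hmf : ∀ u, Injective (mfderiv (𝓡 1) (𝓡 3) k u)) :
    Manifold.IsSmoothEmbedding (𝓡 1) (𝓡 3) ∞ k := by
  have hn : (∞ : WithTop ℕ∞) ≠ 0 := by simp
  set γ : ℝ → 𝔼 4 := fun θ ↦ ((k (circlePoint θ) : 𝕊 3) : 𝔼 4) with hγ_def
  have hcoe : ContMDiff (𝓡 1) 𝓘(ℝ, 𝔼 4) ∞ fun u : 𝕊 1 ↦ ((k u : 𝕊 3) : 𝔼 4) :=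
    contMDiff_coe_sphere.comp hk
  have hγs : ContDiff ℝ ∞ γ := by
    rw [← contMDiff_iff_contDiff]
    exact hcoe.comp contMDiff_circlePoint
  have hmf' : ∀ u, Injective (mfderiv (𝓡 1) 𝓘(ℝ, 𝔼 4) (fun u : 𝕊 1 ↦ ((k u : 𝕊 3) : 𝔼 4)) u) := by
    intro u
    rw [show (fun u : 𝕊 1 ↦ ((k u : 𝕊 3) : 𝔼 4)) = Subtype.val ∘ k from rfl,
      mfderiv_comp u (contMDiff_coe_sphere.mdifferentiableAt hn) (hk.mdifferentiableAt hn)]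
    exact (mfderiv_coe_sphere_injective (n := 3) (k u)).comp (hmf u)
  have hγ : IsRegularClosedCurve γ :=
    { contDiff := hγs
      periodic := fun θ ↦ by simp only [hγ_def, circlePoint_add_two_pi]
      norm_eq_one := fun θ ↦ norm_eq_of_mem_sphere _
      deriv_ne_zero := by
        intro θ h0
        have hcomp : mfderiv 𝓘(ℝ, ℝ) 𝓘(ℝ, 𝔼 4)
            ((fun u : 𝕊 1 ↦ ((k u : 𝕊 3) : 𝔼 4)) ∘ circlePoint) θ =
            (mfderiv (𝓡 1) 𝓘(ℝ, 𝔼 4) (fun u : 𝕊 1 ↦ ((k u : 𝕊 3) : 𝔼 4)) (circlePoint θ)).comp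
              (mfderiv 𝓘(ℝ, ℝ) (𝓡 1) circlePoint θ) :=
          mfderiv_comp θ (hcoe.mdifferentiableAt hn) (contMDiff_circlePoint.mdifferentiableAt hn)
        have h1 : mfderiv 𝓘(ℝ, ℝ) 𝓘(ℝ, 𝔼 4) ((fun u : 𝕊 1 ↦ ((k u : 𝕊 3) : 𝔼 4)) ∘ circlePoint) θ
            (1 : ℝ) = 0 := by
          rw [mfderiv_eq_fderiv]
          exact h0
        rw [hcomp] at h1
        have h2 : mfderiv 𝓘(ℝ, ℝ) (𝓡 1) circlePoint θ (1 : ℝ) = 0 :=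
          hmf' (circlePoint θ) (by rw [map_zero]; exact h1)
        exact mfderiv_circlePoint_apply_ne_zero θ h2 }
  have heq : hγ.toSphereMap = k := by
    funext u
    obtain ⟨θ, rfl⟩ := circlePoint_surjective u
    exact Subtype.ext (hγ.coe_toSphereMap_circlePoint θ)
  rw [← heq]
  exact hγ.isSmoothEmbedding_toSphereMap fun s t hst ↦ hinj (Subtype.ext hst)

/-- **A jointly smooth family of injective immersions of the circle into `𝕊³` is a smooth
isotopy** (`Literature.Topology.FourManifolds.SmoothIsotopy`: every stage is a smooth embedding
by `isSmoothEmbedding_circle_of_injective`). Hirsch (1976), Ch. 8 §1 (isotopies of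
embeddings). [folklore] -/
def SmoothIsotopy.ofCircleFamily (k : ℝ → (𝕊 1) → 𝕊 3)
    (hk : ContMDiff (𝓘(ℝ, ℝ).prod (𝓡 1)) (𝓡 3) ∞ (uncurry k))
    (hinj : ∀ t, Injective (k t)) (hmf : ∀ t u, Injective (mfderiv (𝓡 1) (𝓡 3) (k t) u)) :
    SmoothIsotopy (𝓡 1) (𝓡 3) (k 0) (k 1) where
  toFun := k
  contMDiff := hk
  isSmoothEmbedding t :=
    isSmoothEmbedding_circle_of_injective (hk.comp (contMDiff_const.prodMk contMDiff_id))
      (hinj t) (hmf t)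
  map_zero := rfl
  map_one := rfl

/-- Transport of a smooth isotopy along equalities of its end maps. [folklore] -/
def SmoothIsotopy.copy {EM HM EN HN : Type*} [NormedAddCommGroup EM] [NormedSpace ℝ EM]
    [TopologicalSpace HM] [NormedAddCommGroup EN] [NormedSpace ℝ EN] [TopologicalSpace HN]
    {I : ModelWithCorners ℝ EM HM} {J : ModelWithCorners ℝ EN HN} {M : Type*}
    [TopologicalSpace M] [ChartedSpace HM M] {N : Type*} [TopologicalSpace N] [ChartedSpace HN N]
    {f g f' g' : M → N} (F : SmoothIsotopy I J f g) (hf : f = f') (hg : g = g') :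
    SmoothIsotopy I J f' g' where
  toFun := F.toFun
  contMDiff := F.contMDiff
  isSmoothEmbedding := F.isSmoothEmbedding
  map_zero := F.map_zero.trans hf
  map_one := F.map_one.trans hg

end CircleCriterion

/-! ## Calculus on the closed disc `𝔻²` -/

section ClosedBall

/-- The differential of a map into `𝔻²` is injective as soon as the differential of its
composite with the inclusion `𝔻² ↪ ℝ²` is. [folklore] -/
theorem mfderiv_injective_of_comp_coe_closedBall {EM HM : Type*} [NormedAddCommGroup EM]
    [NormedSpace ℝ EM] [TopologicalSpace HM] {I : ModelWithCorners ℝ EM HM} {M : Type*}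
    [TopologicalSpace M] [ChartedSpace HM M] {g : M → 𝔻 2} {x : M}
    (hg : MDifferentiableAt I (𝓡∂ 2) g x)
    (h : Injective (mfderiv I 𝓘(ℝ, 𝔼 2) (Subtype.val ∘ g) x)) :
    Injective (mfderiv I (𝓡∂ 2) g x) := by
  rw [mfderiv_comp x ((contMDiff_coe_closedBall (n := 1)).mdifferentiableAt (by simp)) hg] at h
  exact Injective.of_comp
    (f := (mfderiv (𝓡∂ 2) 𝓘(ℝ, 𝔼 2) (Subtype.val : (𝔻 2) → 𝔼 2) (g x) : _ → _)) h

/-- The radial retraction has injective differential at interior points. [folklore] -/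
theorem mfderiv_closedBallRetraction_injective {y : 𝔼 2} (hy : ‖y‖ < 1) :
    Injective (mfderiv 𝓘(ℝ, 𝔼 2) (𝓡∂ 2) (closedBallRetraction 2) y) := by
  refine mfderiv_injective_of_comp_coe_closedBall
    ((contMDiffAt_closedBallRetraction (n := 1) hy).mdifferentiableAt (by simp)) ?_
  have heq : (Subtype.val ∘ closedBallRetraction 2 : 𝔼 2 → 𝔼 2) =ᶠ[𝓝 y] id := by
    filter_upwards [Metric.isOpen_ball.mem_nhds (mem_ball_zero_iff.2 hy)] with z hz
    exact closedBallRetraction_of_norm_le 2 (mem_ball_zero_iff.1 hz).le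
  rw [heq.mfderiv_eq, mfderiv_id]
  exact injective_id

end ClosedBall

/-! ## Circles in a disc: shrinking the boundary to a small circle -/

section DiscFamily

variable {f : (𝔻 2) → 𝕊 3}

/-- The membership estimate: `‖a + r • u‖ ≤ ‖a‖ + |r| ≤ 1` for `u` on the unit circle.
[folklore] -/
theorem norm_add_smul_le_one {a : 𝔼 2} {r : ℝ} (h : ‖a‖ + |r| ≤ 1) (u : 𝕊 1) :
    a + r • (u : 𝔼 2) ∈ 𝔻 2 := by
  rw [mem_closedBall_zero_iff]
  calc ‖a + r • (u : 𝔼 2)‖ ≤ ‖a‖ + ‖r • (u : 𝔼 2)‖ := norm_add_le _ _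
    _ = ‖a‖ + |r| := by rw [norm_smul, norm_eq_of_mem_sphere, mul_one, Real.norm_eq_abs]
    _ ≤ 1 := h

/-- **The family of round circles `u ↦ γ t + ρ t • u` in the closed disc** (centre `γ t`, radius
`ρ t`, with `‖γ t‖ + |ρ t| ≤ 1`), as maps `𝕊¹ → 𝔻²`. [folklore] -/
def discCircle (γ : ℝ → 𝔼 2) (ρ : ℝ → ℝ) (h : ∀ t, ‖γ t‖ + |ρ t| ≤ 1) (t : ℝ) (u : 𝕊 1) : 𝔻 2 :=
  ⟨γ t + ρ t • (u : 𝔼 2), norm_add_smul_le_one (h t) u⟩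

variable {γ : ℝ → 𝔼 2} {ρ : ℝ → ℝ} {h : ∀ t, ‖γ t‖ + |ρ t| ≤ 1}

/-- The family of round circles in the disc is jointly smooth into the manifold with boundary
`𝔻²` (smoothness into `𝔻²` is tested in `ℝ²`, `ContMDiff.codRestrict_closedBall`). [folklore] -/
theorem contMDiff_discCircle (hγ : ContDiff ℝ ∞ γ) (hρ : ContDiff ℝ ∞ ρ) :
    ContMDiff (𝓘(ℝ, ℝ).prod (𝓡 1)) (𝓡∂ 2) ∞ (uncurry (discCircle γ ρ h)) := by
  have hG : ContMDiff (𝓘(ℝ, ℝ).prod (𝓡 1)) 𝓘(ℝ, 𝔼 2) ∞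
      fun p : ℝ × (𝕊 1) ↦ γ p.1 + ρ p.1 • (p.2 : 𝔼 2) :=
    (hγ.contMDiff.comp contMDiff_fst).add
      ((hρ.contMDiff.comp contMDiff_fst).smul (contMDiff_coe_sphere.comp contMDiff_snd))
  exact hG.codRestrict_closedBall fun p ↦ norm_add_smul_le_one (h p.1) p.2

/-- Each circle of the family is smooth. [folklore] -/
theorem contMDiff_discCircle_apply (hγ : ContDiff ℝ ∞ γ) (hρ : ContDiff ℝ ∞ ρ) (t : ℝ) :
    ContMDiff (𝓡 1) (𝓡∂ 2) ∞ (discCircle γ ρ h t) :=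
  (contMDiff_discCircle (h := h) hγ hρ).comp (contMDiff_const.prodMk contMDiff_id)

/-- Each circle of the family with nonzero radius is injective. [folklore] -/
theorem discCircle_injective {t : ℝ} (ht : ρ t ≠ 0) : Injective (discCircle γ ρ h t) := by
  intro u v huv
  have h1 : γ t + ρ t • (u : 𝔼 2) = γ t + ρ t • (v : 𝔼 2) := congrArg Subtype.val huv
  exact Subtype.ext (smul_right_injective (𝔼 2) ht (add_left_cancel h1))

/-- Each circle of the family with nonzero radius is an immersion. [folklore] -/
theorem mfderiv_discCircle_injective (hγ : ContDiff ℝ ∞ γ) (hρ : ContDiff ℝ ∞ ρ) {t : ℝ}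
    (ht : ρ t ≠ 0) (u : 𝕊 1) :
    Injective (mfderiv (𝓡 1) (𝓡∂ 2) (discCircle γ ρ h t) u) := by
  have hn : (∞ : WithTop ℕ∞) ≠ 0 := by simp
  refine mfderiv_injective_of_comp_coe_closedBall
    ((contMDiff_discCircle_apply (h := h) hγ hρ t).mdifferentiableAt hn) ?_
  have heq : (Subtype.val ∘ discCircle γ ρ h t : (𝕊 1) → 𝔼 2) =
      (fun y : 𝔼 2 ↦ γ t + ρ t • y) ∘ (Subtype.val : (𝕊 1) → 𝔼 2) := rfl
  have hA : HasFDerivAt (fun y : 𝔼 2 ↦ γ t + ρ t • y) (ρ t • ContinuousLinearMap.id ℝ (𝔼 2))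
      (u : 𝔼 2) := ((hasFDerivAt_id (u : 𝔼 2)).const_smul (ρ t)).const_add (γ t)
  rw [heq, mfderiv_comp u hA.differentiableAt.mdifferentiableAt
    (contMDiff_coe_sphere.mdifferentiableAt hn), mfderiv_eq_fderiv, hA.fderiv]
  have h1 : Injective (ρ t • ContinuousLinearMap.id ℝ (𝔼 2)) := by
    intro a b hab
    simpa [ht] using hab
  exact h1.comp (mfderiv_coe_sphere_injective (n := 1) u)

/-- **Shrinking the boundary of a smooth disc to a small circle is a smooth isotopy.** For a smooth
injective immersion `f : 𝔻² → 𝕊³` of the closed disc and smooth centre/radius functions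
`γ`, `ρ` (`‖γ t‖ + |ρ t| ≤ 1`, `ρ t ≠ 0`), the circles `u ↦ f (γ t + ρ t • u)` form a smooth
isotopy of embeddings `𝕊¹ → 𝕊³`. Hirsch (1976), Ch. 8, proof of Thm. 3.1 (radial isotopy of a
disc). [folklore] -/
def SmoothIsotopy.discCircle (hf : ContMDiff (𝓡∂ 2) (𝓡 3) ∞ f) (hfi : Injective f)
    (hmf : ∀ x, Injective (mfderiv (𝓡∂ 2) (𝓡 3) f x)) (hγ : ContDiff ℝ ∞ γ)
    (hρ : ContDiff ℝ ∞ ρ) (h : ∀ t, ‖γ t‖ + |ρ t| ≤ 1) (h0 : ∀ t, ρ t ≠ 0) :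
    SmoothIsotopy (𝓡 1) (𝓡 3) (f ∘ _root_.Literature.Topology.FourManifolds.discCircle γ ρ h 0)
      (f ∘ _root_.Literature.Topology.FourManifolds.discCircle γ ρ h 1) :=
  SmoothIsotopy.ofCircleFamily
    (fun t ↦ f ∘ _root_.Literature.Topology.FourManifolds.discCircle γ ρ h t)
    (hf.comp (contMDiff_discCircle hγ hρ)) (fun t ↦ hfi.comp (discCircle_injective (h0 t)))
    fun t u ↦ by
      have hn : (∞ : WithTop ℕ∞) ≠ 0 := by simp
      rw [mfderiv_comp u (hf.mdifferentiableAt hn)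
        ((contMDiff_discCircle_apply (h := h) hγ hρ t).mdifferentiableAt hn)]
      exact (hmf _).comp (mfderiv_discCircle_injective (h := h) hγ hρ (h0 t) u)

end DiscFamily

/-! ## Circles in a chart: families of plane curves pushed into `𝕊³` -/

section ChartFamily

/-- `C^∞` maps on a product of model vector spaces (usual sense) are `C^∞` for the product model
with corners, pointwise (Mathlib's `modelWithCornersSelf_prod` / `chartedSpaceSelf_prod`).
[folklore] -/
private theorem contMDiffAt_prodSelf_of_contDiffAt {E F G : Type*} [NormedAddCommGroup E]
    [NormedSpace ℝ E] [NormedAddCommGroup F] [NormedSpace ℝ F] [NormedAddCommGroup G]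
    [NormedSpace ℝ G] {g : E × F → G} {p : E × F} (hg : ContDiffAt ℝ ∞ g p) :
    ContMDiffAt (𝓘(ℝ, E).prod 𝓘(ℝ, F)) 𝓘(ℝ, G) ∞ g p := by
  rw [← modelWithCornersSelf_prod, chartedSpaceSelf_prod]
  exact hg.contMDiffAt

variable (p₀ : 𝕊 3)

/-- The chart of `𝕊³` at `p₀` (stereographic projection from `-p₀`) has full target `ℝ³`.
[folklore] -/
theorem chartAt_sphereThree_target : (chartAt (𝔼 3) p₀).target = univ :=
  stereographic'_target (-p₀)

/-- The inverse chart `ℝ³ → 𝕊³` (inverse stereographic projection) is `C^∞` on all of `ℝ³`.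
[folklore] -/
theorem contMDiff_chartAt_sphereThree_symm :
    ContMDiff 𝓘(ℝ, 𝔼 3) (𝓡 3) ∞ (chartAt (𝔼 3) p₀).symm := by
  have h := contMDiffOn_chart_symm (I := 𝓡 3) (H := 𝔼 3) (x := p₀) (n := ∞)
  rw [chartAt_sphereThree_target] at h
  exact contMDiffOn_univ.1 h

/-- The inverse chart `ℝ³ → 𝕊³` is injective. [folklore] -/
theorem chartAt_sphereThree_symm_injective : Injective (chartAt (𝔼 3) p₀).symm := by
  rw [← injOn_univ, ← chartAt_sphereThree_target p₀]
  exact (chartAt (𝔼 3) p₀).symm.injOn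

/-- The inverse chart `ℝ³ → 𝕊³` has injective differential everywhere. [folklore] -/
theorem mfderiv_chartAt_sphereThree_symm_injective (y : 𝔼 3) :
    Injective (mfderiv 𝓘(ℝ, 𝔼 3) (𝓡 3) (chartAt (𝔼 3) p₀).symm y) :=
  (mdifferentiable_chart (I := 𝓡 3) p₀).symm.mfderiv_injective
    (by rw [OpenPartialHomeomorph.symm_source, chartAt_sphereThree_target]; exact mem_univ y)

/-- On the chart domain, chart followed by inverse chart is the identity. [folklore] -/
theorem chartAt_sphereThree_symm_apply {p : 𝕊 3} (hp : p ∈ (chartAt (𝔼 3) p₀).source) :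
    (chartAt (𝔼 3) p₀).symm (chartAt (𝔼 3) p₀ p) = p :=
  (chartAt (𝔼 3) p₀).left_inv hp

variable {p₀}

/-- **A family of plane curves read in a chart of `𝕊³` is a smooth isotopy of circles.** Let
`G : ℝ → ℝ² → ℝ³` be jointly `C^∞` near `ℝ × 𝕊¹`, with every `G t` injective on the unit circle
and with injective differential there. Then `u ↦ σ⁻¹ (G t u)` (`σ` the stereographic chart at
`p₀`) is a smooth isotopy of embeddings `𝕊¹ → 𝕊³`. [folklore] -/
def SmoothIsotopy.chartCircle (p₀ : 𝕊 3) (G : ℝ → 𝔼 2 → 𝔼 3)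
    (hG : ∀ t (u : 𝕊 1), ContDiffAt ℝ ∞ (uncurry G) (t, u))
    (hinj : ∀ t, Injective fun u : 𝕊 1 ↦ G t u)
    (hD : ∀ t (u : 𝕊 1), Injective (fderiv ℝ (G t) u)) :
    SmoothIsotopy (𝓡 1) (𝓡 3) (fun u : 𝕊 1 ↦ (chartAt (𝔼 3) p₀).symm (G 0 u))
      (fun u : 𝕊 1 ↦ (chartAt (𝔼 3) p₀).symm (G 1 u)) := by
  have hn : (∞ : WithTop ℕ∞) ≠ 0 := by simp
  have hGt : ∀ t (u : 𝕊 1), ContDiffAt ℝ ∞ (G t) u := fun t u ↦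
    (hG t u).comp (u : 𝔼 2) (contDiffAt_const.prodMk contDiffAt_id)
  refine SmoothIsotopy.ofCircleFamily (fun t u ↦ (chartAt (𝔼 3) p₀).symm (G t u)) ?_ ?_ ?_
  · refine (contMDiff_chartAt_sphereThree_symm p₀).comp fun p ↦ ?_
    have h1 : ContMDiffAt (𝓘(ℝ, ℝ).prod (𝓡 1)) (𝓘(ℝ, ℝ).prod 𝓘(ℝ, 𝔼 2)) ∞
        (fun q : ℝ × (𝕊 1) ↦ (q.1, (q.2 : 𝔼 2))) p :=
      contMDiffAt_fst.prodMk (contMDiff_coe_sphere.contMDiffAt.comp p contMDiffAt_snd)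
    exact (contMDiffAt_prodSelf_of_contDiffAt (hG p.1 p.2)).comp p h1
  · exact fun t ↦ (chartAt_sphereThree_symm_injective p₀).comp (hinj t)
  · intro t u
    have hd : MDifferentiableAt 𝓘(ℝ, 𝔼 2) 𝓘(ℝ, 𝔼 3) (G t) (u : 𝔼 2) :=
      ((hGt t u).differentiableAt hn).mdifferentiableAt
    rw [show (fun u : 𝕊 1 ↦ (chartAt (𝔼 3) p₀).symm (G t u)) =
        (chartAt (𝔼 3) p₀).symm ∘ (G t ∘ Subtype.val) from rfl,
      mfderiv_comp u ((contMDiff_chartAt_sphereThree_symm p₀).mdifferentiableAt hn)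
        (hd.comp u (contMDiff_coe_sphere.mdifferentiableAt hn)),
      mfderiv_comp u hd (contMDiff_coe_sphere.mdifferentiableAt hn), mfderiv_eq_fderiv]
    exact (mfderiv_chartAt_sphereThree_symm_injective p₀ _).comp
      ((hD t u).comp (mfderiv_coe_sphere_injective (n := 1) u))

end ChartFamily

/-! ## Linearisation: the straight-line isotopy to the first-order Taylor polynomial -/

section StraightLine

variable {E' F' : Type*} [NormedAddCommGroup E'] [NormedSpace ℝ E'] [FiniteDimensional ℝ E']
  [NormedAddCommGroup F'] [NormedSpace ℝ F']

/-- An injective continuous linear map on a finite-dimensional space is bounded below.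
[folklore] -/
theorem exists_norm_le_mul_norm_of_injective (A : E' →L[ℝ] F') (hA : Injective A) :
    ∃ c > 0, ∀ x, c * ‖x‖ ≤ ‖A x‖ := by
  obtain ⟨K, hK, hanti⟩ := (A : E' →ₗ[ℝ] F').exists_antilipschitzWith
    (LinearMap.ker_eq_bot.2 hA)
  refine ⟨(K : ℝ)⁻¹, by positivity, fun x ↦ ?_⟩
  have h := hanti.le_mul_dist x 0
  simp only [dist_zero_right, LinearMap.map_zero, ContinuousLinearMap.coe_coe] at h
  rw [inv_mul_le_iff₀ (by exact_mod_cast hK)]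
  exact h

omit [FiniteDimensional ℝ E'] in
/-- A continuous linear map close to a map bounded below by `c` is bounded below by `c / 2`, in
particular injective. [folklore] -/
theorem injective_of_norm_sub_le {A B : E' →L[ℝ] F'} {c : ℝ} (hc : 0 < c)
    (hA : ∀ x, c * ‖x‖ ≤ ‖A x‖) (hB : ‖B - A‖ ≤ c / 2) : Injective B := by
  refine (injective_iff_map_eq_zero B).2 fun x hx ↦ ?_
  have h1 : ‖(B - A) x‖ ≤ c / 2 * ‖x‖ := (B - A).le_of_opNorm_le hB x
  have h2 : ‖(B - A) x‖ = ‖A x‖ := by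
    rw [show (B - A) x = B x - A x from rfl, hx, zero_sub, norm_neg]
  by_contra hne
  have hpos : 0 < ‖x‖ := norm_pos_iff.2 hne
  nlinarith [hA x]

/-- **The straight-line isotopy from a map to its linearisation consists of embeddings of a small
ball.** Let `E : ℝᵐ → F` be `C^∞` on the ball `B(0, R₀)` with injective differential `A` at `0`.
Then for some `R ∈ (0, R₀)` and every `s ∈ [0, 1]`, the map
`E_s = (1 - s) E + s (E 0 + A)` is injective on `B(0, R)` with injective differential there.
(Hirsch (1976), Ch. 8, proof of Thm. 3.1, replaces an embedding near `0` by its linearisation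
through the isotopy `t⁻¹ h(t x)`; the straight-line variant used here needs only the mean value
inequality: `‖D E_s - A‖ ≤ c/2` on the ball, where `‖A x‖ ≥ c ‖x‖`.) [folklore] -/
theorem exists_ball_injOn_straightLine {E : E' → F'} {R₀ : ℝ} (hR₀ : 0 < R₀)
    (hE : ContDiffOn ℝ ∞ E (ball 0 R₀)) (hA : Injective (fderiv ℝ E 0)) :
    ∃ R > 0, R < R₀ ∧ ∀ s ∈ Icc (0 : ℝ) 1,
      InjOn (fun y ↦ (1 - s) • E y + s • (E 0 + fderiv ℝ E 0 y)) (ball 0 R) ∧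
      ∀ y ∈ ball (0 : E') R,
        Injective (fderiv ℝ (fun y ↦ (1 - s) • E y + s • (E 0 + fderiv ℝ E 0 y)) y) := by
  set A := fderiv ℝ E 0 with hA_def
  obtain ⟨c, hc, hcA⟩ := exists_norm_le_mul_norm_of_injective A hA
  -- continuity of the derivative at `0`
  have hcont : ContinuousOn (fderiv ℝ E) (ball 0 R₀) :=
    hE.continuousOn_fderiv_of_isOpen isOpen_ball (by simp)
  have h0 : (0 : E') ∈ ball (0 : E') R₀ := mem_ball_self hR₀
  obtain ⟨δ, hδ, hδA⟩ : ∃ δ > 0, ∀ y ∈ ball (0 : E') R₀, dist y 0 < δ →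
      dist (fderiv ℝ E y) A < c / 2 :=
    Metric.continuousWithinAt_iff.1 (hcont 0 h0) (c / 2) (by positivity)
  set R := min (R₀ / 2) δ with hR_def
  have hR : 0 < R := lt_min (by positivity) hδ
  have hRR₀ : R < R₀ := (min_le_left _ _).trans_lt (by linarith)
  have hball : ball (0 : E') R ⊆ ball 0 R₀ := ball_subset_ball hRR₀.le
  have hDA : ∀ y ∈ ball (0 : E') R, ‖fderiv ℝ E y - A‖ ≤ c / 2 := fun y hy ↦ by
    rw [← dist_eq_norm]
    exact (hδA y (hball hy) ((mem_ball.1 hy).trans_le (min_le_right _ _))).le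
  have hdiff : ∀ y ∈ ball (0 : E') R, DifferentiableAt ℝ E y := fun y hy ↦
    (hE.differentiableOn (by simp)).differentiableAt (isOpen_ball.mem_nhds (hball hy))
  refine ⟨R, hR, hRR₀, fun s hs ↦ ?_⟩
  -- the derivative of the straight-line stage
  have hderiv : ∀ y ∈ ball (0 : E') R,
      HasFDerivAt (fun y ↦ (1 - s) • E y + s • (E 0 + A y)) ((1 - s) • fderiv ℝ E y + s • A) y :=
    fun y hy ↦ ((hdiff y hy).hasFDerivAt.const_smul (1 - s)).add
      ((A.hasFDerivAt.const_add (E 0)).const_smul s)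
  have hclose : ∀ y ∈ ball (0 : E') R, ‖((1 - s) • fderiv ℝ E y + s • A) - A‖ ≤ c / 2 := by
    intro y hy
    have : (1 - s) • fderiv ℝ E y + s • A - A = (1 - s) • (fderiv ℝ E y - A) := by
      simp only [smul_sub, sub_smul, one_smul]; abel
    rw [this, norm_smul, Real.norm_of_nonneg (by linarith [hs.2])]
    calc (1 - s) * ‖fderiv ℝ E y - A‖ ≤ 1 * (c / 2) :=
          mul_le_mul (by linarith [hs.1]) (hDA y hy) (norm_nonneg _) zero_le_one
      _ = c / 2 := one_mul _
  refine ⟨?_, fun y hy ↦ ?_⟩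
  · -- injectivity on the ball, by the mean value inequality for `E_s - A`
    intro y hy y' hy' hyy'
    have hφ : ∀ z ∈ ball (0 : E') R,
        HasFDerivWithinAt (fun z ↦ (1 - s) • E z + s • (E 0 + A z) - A z)
          ((1 - s) • fderiv ℝ E z + s • A - A) (ball 0 R) z :=
      fun z hz ↦ ((hderiv z hz).sub A.hasFDerivAt).hasFDerivWithinAt
    have hmv := (convex_ball (0 : E') R).norm_image_sub_le_of_norm_hasFDerivWithin_le hφ
      (fun z hz ↦ hclose z hz) hy' hy
    have hyy'' : (1 - s) • E y + s • (E 0 + A y) = (1 - s) • E y' + s • (E 0 + A y') := hyy'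
    have hEq : (1 - s) • E y + s • (E 0 + A y) - A y - ((1 - s) • E y' + s • (E 0 + A y') - A y') =
        -(A (y - y')) := by
      rw [hyy'', map_sub]; abel
    rw [hEq, norm_neg] at hmv
    by_contra hne
    have hpos : 0 < ‖y - y'‖ := norm_pos_iff.2 (sub_ne_zero.2 hne)
    nlinarith [hcA (y - y')]
  · rw [(hderiv y hy).fderiv]
    exact injective_of_norm_sub_le hc hcA (hclose y hy)

end StraightLine

/-! ## From the boundary of a disc to a linear circle in a chart -/

section DiscToLinear

variable (p₀ : 𝕊 3) {f : (𝔻 2) → 𝕊 3}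

/-- Membership in the domain of the chart of `𝕊³` at `p₀`: every point except `-p₀`. [folklore] -/
theorem mem_chartAt_sphereThree_source {p : 𝕊 3} : p ∈ (chartAt (𝔼 3) p₀).source ↔ p ≠ -p₀ := by
  rw [show (chartAt (𝔼 3) p₀).source = {-p₀}ᶜ from stereographic'_source (-p₀)]
  rfl

/-- An interior centre `c` of the disc (`‖c‖ ≤ 1/2`) whose image avoids the pole `-p₀` of the
chart at `p₀` (two candidate centres, `f` being injective). [folklore] -/
theorem exists_center_mem_source (hfi : Injective f) :
    ∃ c : 𝔼 2, ∃ hc : ‖c‖ ≤ 1 / 2,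
      f ⟨c, mem_closedBall_zero_iff.2 (hc.trans (by norm_num))⟩ ∈ (chartAt (𝔼 3) p₀).source := by
  by_cases h0 : f ⟨0, mem_closedBall_zero_iff.2 (by norm_num)⟩ ∈ (chartAt (𝔼 3) p₀).source
  · exact ⟨0, by norm_num, h0⟩
  · set c : 𝔼 2 := EuclideanSpace.single 0 (1 / 2) with hc_def
    have hc : ‖c‖ ≤ 1 / 2 := by
      rw [hc_def, PiLp.norm_single, Real.norm_of_nonneg (by norm_num)]
    refine ⟨c, hc, ?_⟩
    rw [mem_chartAt_sphereThree_source] at h0 ⊢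
    intro h1
    apply h0
    intro h2
    have h12 := hfi (h1.trans h2.symm)
    have : c = 0 := congrArg Subtype.val h12
    have h3 : c 0 = (0 : 𝔼 2) 0 := by rw [this]
    simp [hc_def] at h3

variable {p₀}

/-- **Step 1: shrinking the boundary circle inside the disc.** For a smooth injective immersion
`f : 𝔻² → 𝕊³`, a centre `c` with `‖c‖ ≤ 1/2` and a radius `0 < r ≤ 1/2`, the boundary circle
`u ↦ f u` is smoothly isotopic to the small circle `u ↦ f (c + r u)` (the family of round
circles with centre `χ(t) c` and radius `1 - χ(t) (1 - r)`, `χ` Mathlib's `Real.smoothTransition`;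
`SmoothIsotopy.discCircle`). Hirsch (1976), Ch. 8, proof of Thm. 3.1 (radial isotopy).
[folklore] -/
theorem isSmoothlyIsotopic_boundary_smallCircle (hf : ContMDiff (𝓡∂ 2) (𝓡 3) ∞ f)
    (hfi : Injective f) (hmf : ∀ x, Injective (mfderiv (𝓡∂ 2) (𝓡 3) f x)) {c : 𝔼 2}
    (hc : ‖c‖ ≤ 1 / 2) {r : ℝ} (hr : 0 < r) (hr2 : r ≤ 1 / 2) :
    IsSmoothlyIsotopic (𝓡 1) (𝓡 3) (fun u : 𝕊 1 ↦ f ⟨u, sphere_subset_closedBall u.2⟩)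
      (fun u : 𝕊 1 ↦ f ⟨c + r • (u : 𝔼 2), norm_add_smul_le_one
        (show ‖c‖ + |r| ≤ 1 by rw [abs_of_pos hr]; linarith) u⟩) := by
  set χ := Real.smoothTransition with hχ_def
  have hχ : ContDiff ℝ ∞ χ := Real.smoothTransition.contDiff
  have hχ01 : ∀ t, χ t ∈ Icc (0 : ℝ) 1 := fun t ↦
    ⟨Real.smoothTransition.nonneg t, Real.smoothTransition.le_one t⟩
  set γ : ℝ → 𝔼 2 := fun t ↦ χ t • c with hγ_def
  set ρ : ℝ → ℝ := fun t ↦ 1 - χ t * (1 - r) with hρ_def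
  have hγs : ContDiff ℝ ∞ γ := hχ.smul contDiff_const
  have hρs : ContDiff ℝ ∞ ρ := contDiff_const.sub (hχ.mul contDiff_const)
  have hρpos : ∀ t, 0 < ρ t := fun t ↦ by
    have := hχ01 t
    simp only [hρ_def]
    nlinarith [this.1, this.2]
  have hγρ : ∀ t, ‖γ t‖ + |ρ t| ≤ 1 := fun t ↦ by
    have h01 := hχ01 t
    rw [abs_of_pos (hρpos t), hγ_def, hρ_def]
    dsimp only
    rw [norm_smul, Real.norm_of_nonneg h01.1]
    nlinarith [h01.1, h01.2, norm_nonneg c]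
  have I₁ := SmoothIsotopy.discCircle hf hfi hmf hγs hρs hγρ fun t ↦ (hρpos t).ne'
  have hχ0 : χ 0 = 0 := Real.smoothTransition.zero
  have hχ1 : χ 1 = 1 := Real.smoothTransition.one
  refine ⟨I₁.copy ?_ ?_⟩
  · funext u
    show f (discCircle γ ρ hγρ 0 u) = f ⟨u, _⟩
    congr 1
    refine Subtype.ext ?_
    show χ 0 • c + (1 - χ 0 * (1 - r)) • (u : 𝔼 2) = u
    rw [hχ0]; simp
  · funext u
    show f (discCircle γ ρ hγρ 1 u) = f ⟨c + r • (u : 𝔼 2), _⟩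
    congr 1
    refine Subtype.ext ?_
    show χ 1 • c + (1 - χ 1 * (1 - r)) • (u : 𝔼 2) = c + r • u
    rw [hχ1]; simp

/-- **Step 2: the straight-line isotopy in the chart.** If `E : ℝ² → ℝ³` is `C^∞` on `B(0, R₀)`
with injective differential `A` at `0`, then for all small `r > 0` the circle
`u ↦ σ⁻¹ (E (r u))` is smoothly isotopic to `u ↦ σ⁻¹ (E 0 + r A u)`
(`exists_ball_injOn_straightLine`, `SmoothIsotopy.chartCircle`). Hirsch (1976), Ch. 8, proof
of Thm. 3.1 (linearisation). [folklore] -/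
theorem exists_isSmoothlyIsotopic_straightLine (p₀ : 𝕊 3) {E : 𝔼 2 → 𝔼 3} {R₀ : ℝ}
    (hR₀ : 0 < R₀) (hE : ContDiffOn ℝ ∞ E (ball 0 R₀)) (hA : Injective (fderiv ℝ E 0)) :
    ∃ R > 0, R < R₀ ∧ ∀ r, 0 < r → r < R →
      IsSmoothlyIsotopic (𝓡 1) (𝓡 3) (fun u : 𝕊 1 ↦ (chartAt (𝔼 3) p₀).symm (E (r • (u : 𝔼 2))))
        (fun u : 𝕊 1 ↦ (chartAt (𝔼 3) p₀).symm (E 0 + (r • fderiv ℝ E 0) u)) := by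
  have hn : (∞ : WithTop ℕ∞) ≠ 0 := by simp
  set A := fderiv ℝ E 0 with hA_def
  obtain ⟨R, hR, hRR₀, hSL⟩ := exists_ball_injOn_straightLine hR₀ hE hA
  refine ⟨R, hR, hRR₀, fun r hr hrR ↦ ?_⟩
  have hEat : ∀ y ∈ ball (0 : 𝔼 2) R₀, ContDiffAt ℝ ∞ E y := fun y hy ↦
    hE.contDiffAt (isOpen_ball.mem_nhds hy)
  have hru : ∀ u : 𝕊 1, r • (u : 𝔼 2) ∈ ball (0 : 𝔼 2) R := fun u ↦ by
    rw [mem_ball_zero_iff, norm_smul, norm_eq_of_mem_sphere, mul_one, Real.norm_of_nonneg hr.le]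
    exact hrR
  have hru₀ : ∀ u : 𝕊 1, r • (u : 𝔼 2) ∈ ball (0 : 𝔼 2) R₀ := fun u ↦
    ball_subset_ball hRR₀.le (hru u)
  set χ := Real.smoothTransition with hχ_def
  have hχ : ContDiff ℝ ∞ χ := Real.smoothTransition.contDiff
  have hχ01 : ∀ t, χ t ∈ Icc (0 : ℝ) 1 := fun t ↦
    ⟨Real.smoothTransition.nonneg t, Real.smoothTransition.le_one t⟩
  set G₁ : ℝ → 𝔼 2 → 𝔼 3 := fun t y ↦
    (1 - χ t) • E (r • y) + χ t • (E 0 + A (r • y)) with hG₁_def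
  have hG₁s : ∀ t (u : 𝕊 1), ContDiffAt ℝ ∞ (uncurry G₁) (t, u) := by
    intro t u
    have hsm : ContDiffAt ℝ ∞ (fun q : ℝ × 𝔼 2 ↦ r • q.2) (t, (u : 𝔼 2)) :=
      contDiffAt_snd.const_smul r
    have hEu : ContDiffAt ℝ ∞ (fun q : ℝ × 𝔼 2 ↦ E (r • q.2)) (t, (u : 𝔼 2)) :=
      ContDiffAt.comp (g := E) (f := fun q : ℝ × 𝔼 2 ↦ r • q.2) (t, (u : 𝔼 2))
        (hEat _ (hru₀ u)) hsm
    have hAu : ContDiffAt ℝ ∞ (fun q : ℝ × 𝔼 2 ↦ A (r • q.2)) (t, (u : 𝔼 2)) :=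
      ContDiffAt.comp (g := (A : 𝔼 2 → 𝔼 3)) (f := fun q : ℝ × 𝔼 2 ↦ r • q.2) (t, (u : 𝔼 2))
        A.contDiff.contDiffAt hsm
    have hχt : ContDiffAt ℝ ∞ (fun q : ℝ × 𝔼 2 ↦ χ q.1) (t, (u : 𝔼 2)) :=
      hχ.contDiffAt.comp _ contDiffAt_fst
    exact ((contDiffAt_const.sub hχt).smul hEu).add (hχt.smul (contDiffAt_const.add hAu))
  have hG₁eq : ∀ t, G₁ t = (fun y ↦ (1 - χ t) • E y + χ t • (E 0 + A y)) ∘ fun y ↦ r • y :=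
    fun t ↦ rfl
  have hG₁inj : ∀ t, Injective fun u : 𝕊 1 ↦ G₁ t u := by
    intro t u v huv
    have h1 := (hSL (χ t) (hχ01 t)).1 (hru u) (hru v) huv
    exact Subtype.ext (smul_right_injective (𝔼 2) hr.ne' h1)
  have hG₁D : ∀ t (u : 𝕊 1), Injective (fderiv ℝ (G₁ t) u) := by
    intro t u
    have hs := hSL (χ t) (hχ01 t)
    have hsm : HasFDerivAt (fun y : 𝔼 2 ↦ r • y) (r • ContinuousLinearMap.id ℝ (𝔼 2)) (u : 𝔼 2) :=
      (hasFDerivAt_id _).const_smul r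
    have hEd : DifferentiableAt ℝ E (r • (u : 𝔼 2)) := (hEat _ (hru₀ u)).differentiableAt hn
    have hstage : HasFDerivAt (fun y ↦ (1 - χ t) • E y + χ t • (E 0 + A y))
        ((1 - χ t) • fderiv ℝ E (r • (u : 𝔼 2)) + χ t • A) (r • (u : 𝔼 2)) :=
      (hEd.hasFDerivAt.const_smul (1 - χ t)).add ((A.hasFDerivAt.const_add (E 0)).const_smul (χ t))
    rw [hG₁eq t, fderiv_comp _ hstage.differentiableAt hsm.differentiableAt, hsm.fderiv]
    refine (hs.2 _ (hru u)).comp ?_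
    intro a b hab
    simpa [hr.ne'] using hab
  have I₂ := SmoothIsotopy.chartCircle p₀ G₁ hG₁s hG₁inj hG₁D
  have hχ0 : χ 0 = 0 := Real.smoothTransition.zero
  have hχ1 : χ 1 = 1 := Real.smoothTransition.one
  refine ⟨I₂.copy ?_ ?_⟩
  · funext u
    show (chartAt (𝔼 3) p₀).symm (G₁ 0 u) = _
    congr 1
    show (1 - χ 0) • E (r • u) + χ 0 • (E 0 + A (r • u)) = E (r • u)
    rw [hχ0]; simp
  · funext u
    show (chartAt (𝔼 3) p₀).symm (G₁ 1 u) = _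
    congr 1
    show (1 - χ 1) • E (r • u) + χ 1 • (E 0 + A (r • u)) = E 0 + (r • A) u
    rw [hχ1, show (r • A) u = r • A u from rfl, map_smul]; simp

/-- **Step 3: translating a linear circle in the chart** (`u ↦ σ⁻¹ (q + B u)` to
`u ↦ σ⁻¹ (B u)` along `(1 - χ t) q`). [folklore] -/
theorem isSmoothlyIsotopic_translate (p₀ : 𝕊 3) (q : 𝔼 3) {B : 𝔼 2 →L[ℝ] 𝔼 3}
    (hB : Injective B) :
    IsSmoothlyIsotopic (𝓡 1) (𝓡 3) (fun u : 𝕊 1 ↦ (chartAt (𝔼 3) p₀).symm (q + B u))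
      (fun u : 𝕊 1 ↦ (chartAt (𝔼 3) p₀).symm (B u)) := by
  set χ := Real.smoothTransition with hχ_def
  have hχ : ContDiff ℝ ∞ χ := Real.smoothTransition.contDiff
  set G₂ : ℝ → 𝔼 2 → 𝔼 3 := fun t y ↦ (1 - χ t) • q + B y with hG₂_def
  have hG₂s : ∀ t (u : 𝕊 1), ContDiffAt ℝ ∞ (uncurry G₂) (t, u) := by
    intro t u
    have hχt : ContDiffAt ℝ ∞ (fun p : ℝ × 𝔼 2 ↦ χ p.1) (t, (u : 𝔼 2)) :=
      hχ.contDiffAt.comp _ contDiffAt_fst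
    exact ((contDiffAt_const.sub hχt).smul contDiffAt_const).add
      (B.contDiff.contDiffAt.comp _ contDiffAt_snd)
  have hG₂inj : ∀ t, Injective fun u : 𝕊 1 ↦ G₂ t u := by
    intro t u v huv
    exact Subtype.ext (hB (add_left_cancel huv))
  have hG₂D : ∀ t (u : 𝕊 1), Injective (fderiv ℝ (G₂ t) u) := by
    intro t u
    rw [show G₂ t = fun y ↦ (1 - χ t) • q + B y from rfl, fderiv_const_add, B.fderiv]
    exact hB
  have I₃ := SmoothIsotopy.chartCircle p₀ G₂ hG₂s hG₂inj hG₂D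
  have hχ0 : χ 0 = 0 := Real.smoothTransition.zero
  have hχ1 : χ 1 = 1 := Real.smoothTransition.one
  refine ⟨I₃.copy ?_ ?_⟩
  · funext u
    show (chartAt (𝔼 3) p₀).symm (G₂ 0 u) = _
    congr 1
    show (1 - χ 0) • q + B u = q + B u
    rw [hχ0]; simp
  · funext u
    show (chartAt (𝔼 3) p₀).symm (G₂ 1 u) = _
    congr 1
    show (1 - χ 1) • q + B u = B u
    rw [hχ1]; simp

/-- **From the boundary circle of a smooth disc to a linear circle in a chart.** For a smooth
injective immersion `f : 𝔻² → 𝕊³` of the closed disc, the boundary circle `u ↦ f u` is smoothly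
isotopic, through embeddings `𝕊¹ → 𝕊³`, to a "linear circle" `u ↦ σ⁻¹ (B u)` for the chart `σ`
of `𝕊³` at `p₀` and some injective linear map `B : ℝ² → ℝ³`. The isotopy is: shrink the boundary
circle inside the disc to a small circle about an interior point `c` with `f c ≠ -p₀`
(`isSmoothlyIsotopic_boundary_smallCircle`); in the chart, replace the small circle
`σ (f (c + r u))` by its linearisation `σ (f c) + r A u` through the straight-line isotopy
(`exists_isSmoothlyIsotopic_straightLine`); translate the centre to `0`
(`isSmoothlyIsotopic_translate`). Hirsch (1976), Ch. 8, proof of Thm. 3.1 (pp. 185–186: radial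
isotopy into a chart, linearisation `t⁻¹ h(t x)`). [cite: HirschDT1976, Ch. 8 Thm. 3.1 (proof)] -/
theorem exists_isSmoothlyIsotopic_disc_linear (p₀ : 𝕊 3) (hf : ContMDiff (𝓡∂ 2) (𝓡 3) ∞ f)
    (hfi : Injective f) (hmf : ∀ x, Injective (mfderiv (𝓡∂ 2) (𝓡 3) f x)) :
    ∃ B : 𝔼 2 →L[ℝ] 𝔼 3, Injective B ∧
      IsSmoothlyIsotopic (𝓡 1) (𝓡 3) (fun u : 𝕊 1 ↦ f ⟨u, sphere_subset_closedBall u.2⟩)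
        (fun u : 𝕊 1 ↦ (chartAt (𝔼 3) p₀).symm (B u)) := by
  have hn : (∞ : WithTop ℕ∞) ≠ 0 := by simp
  set σ := chartAt (𝔼 3) p₀ with hσ_def
  obtain ⟨c, hc, hcs⟩ := exists_center_mem_source p₀ hfi
  have hc1 : ‖c‖ < 1 := hc.trans_lt (by norm_num)
  set π : 𝔼 2 → 𝔻 2 := closedBallRetraction 2 with hπ_def
  have hπc : ∀ {y : 𝔼 2} (hy : ‖y‖ ≤ 1), π y = ⟨y, mem_closedBall_zero_iff.2 hy⟩ := fun hy ↦
    Subtype.ext (closedBallRetraction_of_norm_le 2 hy)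
  -- the disc read in the chart, recentred at `c`
  set Ef : 𝔼 2 → 𝔼 3 := fun y ↦ σ (f (π (c + y))) with hEf_def
  set W : Set (𝔼 2) := {y | ‖c + y‖ < 1 ∧ f (π (c + y)) ∈ σ.source} with hW_def
  have hWo : IsOpen W := by
    refine (isOpen_lt (continuous_const.add continuous_id).norm continuous_const).inter ?_
    exact σ.open_source.preimage (hf.continuous.comp
      ((continuous_closedBallRetraction 2).comp (continuous_const.add continuous_id)))
  have hc0 : ‖c + 0‖ < 1 := by simpa using hc1
  have h0W : (0 : 𝔼 2) ∈ W := by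
    refine ⟨hc0, ?_⟩
    show f (π (c + 0)) ∈ σ.source
    rwa [add_zero, hπc hc1.le]
  have hEat : ∀ y ∈ W, ContDiffAt ℝ ∞ Ef y := by
    rintro y ⟨hy1, hy2⟩
    rw [← contMDiffAt_iff_contDiffAt]
    have h1 : ContMDiffAt 𝓘(ℝ, 𝔼 2) 𝓘(ℝ, 𝔼 2) ∞ (fun y : 𝔼 2 ↦ c + y) y :=
      (contDiff_const.add contDiff_id).contDiffAt.contMDiffAt
    have h2 : ContMDiffAt 𝓘(ℝ, 𝔼 2) (𝓡∂ 2) ∞ π (c + y) :=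
      contMDiffAt_closedBallRetraction (n := 1) hy1
    have h3 : ContMDiffAt (𝓡∂ 2) (𝓡 3) ∞ f (π (c + y)) := hf.contMDiffAt
    have h4 : ContMDiffAt (𝓡 3) 𝓘(ℝ, 𝔼 3) ∞ σ (f (π (c + y))) :=
      (contMDiffOn_chart (I := 𝓡 3) (H := 𝔼 3) (x := p₀)).contMDiffAt (σ.open_source.mem_nhds hy2)
    exact h4.comp y (h3.comp y (h2.comp y h1))
  obtain ⟨R₀, hR₀, hR₀W⟩ := Metric.isOpen_iff.1 hWo 0 h0W
  have hE : ContDiffOn ℝ ∞ Ef (ball 0 R₀) := fun y hy ↦ (hEat y (hR₀W hy)).contDiffWithinAt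
  -- the differential of `Ef` at `0` is injective (chain rule)
  have hA : Injective (fderiv ℝ Ef 0) := by
    have hτ : HasFDerivAt (fun y : 𝔼 2 ↦ c + y) (ContinuousLinearMap.id ℝ (𝔼 2)) 0 :=
      (hasFDerivAt_id (0 : 𝔼 2)).const_add c
    have hτm : MDifferentiableAt 𝓘(ℝ, 𝔼 2) 𝓘(ℝ, 𝔼 2) (fun y : 𝔼 2 ↦ c + y) 0 :=
      hτ.differentiableAt.mdifferentiableAt
    have hπm : MDifferentiableAt 𝓘(ℝ, 𝔼 2) (𝓡∂ 2) π (c + 0) :=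
      (contMDiffAt_closedBallRetraction (n := 1) hc0).mdifferentiableAt hn
    have hfm : MDifferentiableAt (𝓡∂ 2) (𝓡 3) f (π (c + 0)) := hf.mdifferentiableAt hn
    have hσm : MDifferentiableAt (𝓡 3) 𝓘(ℝ, 𝔼 3) σ (f (π (c + 0))) :=
      (mdifferentiable_chart (I := 𝓡 3) p₀).mdifferentiableAt h0W.2
    have key : mfderiv 𝓘(ℝ, 𝔼 2) 𝓘(ℝ, 𝔼 3) Ef 0 =
        (mfderiv (𝓡 3) 𝓘(ℝ, 𝔼 3) σ (f (π (c + 0)))).comp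
          ((mfderiv (𝓡∂ 2) (𝓡 3) f (π (c + 0))).comp
            ((mfderiv 𝓘(ℝ, 𝔼 2) (𝓡∂ 2) π (c + 0)).comp
              (mfderiv 𝓘(ℝ, 𝔼 2) 𝓘(ℝ, 𝔼 2) (fun y : 𝔼 2 ↦ c + y) 0))) :=
      (hσm.hasMFDerivAt.comp (0 : 𝔼 2)
        (hfm.hasMFDerivAt.comp (0 : 𝔼 2) (hπm.hasMFDerivAt.comp (0 : 𝔼 2) hτm.hasMFDerivAt))).mfderiv
    have hτi : Injective (mfderiv 𝓘(ℝ, 𝔼 2) 𝓘(ℝ, 𝔼 2) (fun y : 𝔼 2 ↦ c + y) 0) := by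
      rw [mfderiv_eq_fderiv, hτ.fderiv]
      exact injective_id
    rw [← mfderiv_eq_fderiv, key]
    exact ((mdifferentiable_chart (I := 𝓡 3) p₀).mfderiv_injective h0W.2).comp
      ((hmf _).comp ((mfderiv_closedBallRetraction_injective hc0).comp hτi))
  -- the radius
  obtain ⟨R, hR, hRR₀, hSL⟩ := exists_isSmoothlyIsotopic_straightLine p₀ hR₀ hE hA
  set r := min (R / 2) (1 / 2) with hr_def
  have hr : 0 < r := lt_min (by positivity) (by norm_num)
  have hrR : r < R := (min_le_left _ _).trans_lt (by linarith)
  have hr2 : r ≤ 1 / 2 := min_le_right _ _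
  have hruW : ∀ u : 𝕊 1, r • (u : 𝔼 2) ∈ W := fun u ↦ by
    refine hR₀W (ball_subset_ball hRR₀.le ?_)
    rw [mem_ball_zero_iff, norm_smul, norm_eq_of_mem_sphere, mul_one, Real.norm_of_nonneg hr.le]
    exact hrR
  -- the three isotopies
  have I₁ := isSmoothlyIsotopic_boundary_smallCircle hf hfi hmf hc hr hr2
  have I₂ := hSL r hr hrR
  have hB : Injective (r • fderiv ℝ Ef 0) := fun a b hab ↦
    hA (smul_right_injective (𝔼 3) hr.ne' (hab : r • fderiv ℝ Ef 0 a = r • fderiv ℝ Ef 0 b))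
  have I₃ := isSmoothlyIsotopic_translate p₀ (Ef 0) hB
  refine ⟨r • fderiv ℝ Ef 0, hB, ?_⟩
  -- matching the ends: `f (c + r u) = σ⁻¹ (Ef (r u))`
  have h12 : (fun u : 𝕊 1 ↦ f ⟨c + r • (u : 𝔼 2), norm_add_smul_le_one
        (show ‖c‖ + |r| ≤ 1 by rw [abs_of_pos hr]; linarith) u⟩) =
      fun u : 𝕊 1 ↦ σ.symm (Ef (r • (u : 𝔼 2))) := by
    funext u
    have hle : ‖c + r • (u : 𝔼 2)‖ ≤ 1 := mem_closedBall_zero_iff.1 (norm_add_smul_le_one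
      (show ‖c‖ + |r| ≤ 1 by rw [abs_of_pos hr]; linarith) u)
    show _ = σ.symm (σ (f (π (c + r • (u : 𝔼 2)))))
    rw [σ.left_inv (hruW u).2, hπc hle]
  rw [h12] at I₁
  exact IsSmoothlyIsotopic.trans_holds (IsSmoothlyIsotopic.trans_holds I₁ I₂) I₃

end DiscToLinear

/-! ## Linear circles in a chart are all isotopic -/

section LinearCircles

open Submodule

/-- The linear map `ℝ² → ℝ³` with columns `b₁`, `b₂`: `x ↦ x₀ b₁ + x₁ b₂`. [folklore] -/
def colMap (b₁ b₂ : 𝔼 3) : 𝔼 2 →L[ℝ] 𝔼 3 :=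
  (EuclideanSpace.proj (0 : Fin 2)).smulRight b₁ + (EuclideanSpace.proj (1 : Fin 2)).smulRight b₂

/-- `colMap b₁ b₂ x = x₀ b₁ + x₁ b₂`. [folklore] -/
@[simp]
theorem colMap_apply (b₁ b₂ : 𝔼 3) (x : 𝔼 2) : colMap b₁ b₂ x = x 0 • b₁ + x 1 • b₂ := rfl

/-- Every linear map `ℝ² → ℝ³` is the column map of its values on the standard basis. [folklore] -/
theorem eq_colMap (B : 𝔼 2 →L[ℝ] 𝔼 3) :
    B = colMap (B (EuclideanSpace.single 0 1)) (B (EuclideanSpace.single 1 1)) := by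
  ext1 x
  have hx : x = x 0 • EuclideanSpace.single 0 1 + x 1 • EuclideanSpace.single 1 1 := by
    have h := (EuclideanSpace.basisFun (Fin 2) ℝ).sum_repr x
    simp only [EuclideanSpace.basisFun_repr, EuclideanSpace.basisFun_apply, Fin.sum_univ_two] at h
    exact h.symm
  conv_lhs => rw [hx]
  rw [map_add, map_smul, map_smul, colMap_apply]

/-- **Rank-one moves of the first column stay injective**: if `colMap u v` is injective and
`p ∉ span {u, v}`, then `colMap (u + s p) v` is injective for every `s`. [folklore] -/
theorem injective_colMap_add_smul_fst {u v p : 𝔼 3} (h : Injective (colMap u v))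
    (hp : p ∉ span ℝ ({u, v} : Set (𝔼 3))) (s : ℝ) : Injective (colMap (u + s • p) v) := by
  refine (injective_iff_map_eq_zero _).2 fun x hx ↦ ?_
  rw [colMap_apply] at hx
  have hx' : (x 0 • u + x 1 • v) + (s * x 0) • p = 0 := by
    rw [← hx, smul_add, smul_smul, mul_comm]; abel
  by_cases hs : s * x 0 = 0
  · rw [hs, zero_smul, add_zero] at hx'
    exact (injective_iff_map_eq_zero _).1 h x (by rw [colMap_apply]; exact hx')
  · exfalso
    apply hp
    rw [mem_span_pair]
    refine ⟨-(s * x 0)⁻¹ * x 0, -(s * x 0)⁻¹ * x 1, ?_⟩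
    have : p = -(s * x 0)⁻¹ • (x 0 • u + x 1 • v) := by
      rw [neg_smul, eq_neg_iff_add_eq_zero, ← smul_right_injective (𝔼 3) hs |>.eq_iff, smul_add,
        smul_smul, mul_inv_cancel₀ hs, one_smul, smul_zero, add_comm]
      exact hx'
    rw [this, smul_add, smul_smul, smul_smul]

/-- **Rank-one moves of the second column stay injective.** [folklore] -/
theorem injective_colMap_add_smul_snd {u v p : 𝔼 3} (h : Injective (colMap u v))
    (hp : p ∉ span ℝ ({u, v} : Set (𝔼 3))) (s : ℝ) : Injective (colMap u (v + s • p)) := by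
  refine (injective_iff_map_eq_zero _).2 fun x hx ↦ ?_
  rw [colMap_apply] at hx
  have hx' : (x 0 • u + x 1 • v) + (s * x 1) • p = 0 := by
    rw [← hx, smul_add, smul_smul, mul_comm]; abel
  by_cases hs : s * x 1 = 0
  · rw [hs, zero_smul, add_zero] at hx'
    exact (injective_iff_map_eq_zero _).1 h x (by rw [colMap_apply]; exact hx')
  · exfalso
    apply hp
    rw [mem_span_pair]
    refine ⟨-(s * x 1)⁻¹ * x 0, -(s * x 1)⁻¹ * x 1, ?_⟩
    have : p = -(s * x 1)⁻¹ • (x 0 • u + x 1 • v) := by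
      rw [neg_smul, eq_neg_iff_add_eq_zero, ← smul_right_injective (𝔼 3) hs |>.eq_iff, smul_add,
        smul_smul, mul_inv_cancel₀ hs, one_smul, smul_zero, add_comm]
      exact hx'
    rw [this, smul_add, smul_smul, smul_smul]

variable (p₀ : 𝕊 3)

/-- **A smooth path of injective column maps is a smooth isotopy of linear circles** (first
column moving along `u + χ(t) p`). [folklore] -/
theorem isSmoothlyIsotopic_colMap_fst {u v p : 𝔼 3} (h : Injective (colMap u v))
    (hp : p ∉ span ℝ ({u, v} : Set (𝔼 3))) :
    IsSmoothlyIsotopic (𝓡 1) (𝓡 3) (fun w : 𝕊 1 ↦ (chartAt (𝔼 3) p₀).symm (colMap u v w))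
      (fun w : 𝕊 1 ↦ (chartAt (𝔼 3) p₀).symm (colMap (u + p) v w)) := by
  set χ := Real.smoothTransition with hχ_def
  have hχ : ContDiff ℝ ∞ χ := Real.smoothTransition.contDiff
  set G : ℝ → 𝔼 2 → 𝔼 3 := fun t y ↦ colMap (u + χ t • p) v y with hG_def
  have hGs : ∀ t (w : 𝕊 1), ContDiffAt ℝ ∞ (uncurry G) (t, w) := by
    intro t w
    have h0 : ContDiffAt ℝ ∞ (fun q : ℝ × 𝔼 2 ↦ q.2 0) (t, (w : 𝔼 2)) :=
      ((contDiff_piLp_apply (p := 2) (i := (0 : Fin 2))).comp contDiff_snd).contDiffAt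
    have h1 : ContDiffAt ℝ ∞ (fun q : ℝ × 𝔼 2 ↦ q.2 1) (t, (w : 𝔼 2)) :=
      ((contDiff_piLp_apply (p := 2) (i := (1 : Fin 2))).comp contDiff_snd).contDiffAt
    have hχt : ContDiffAt ℝ ∞ (fun q : ℝ × 𝔼 2 ↦ χ q.1) (t, (w : 𝔼 2)) :=
      hχ.contDiffAt.comp _ contDiffAt_fst
    have : uncurry G = fun q : ℝ × 𝔼 2 ↦ q.2 0 • (u + χ q.1 • p) + q.2 1 • v := by
      funext q; rfl
    rw [this]
    exact (h0.smul (contDiffAt_const.add (hχt.smul contDiffAt_const))).add (h1.smul contDiffAt_const)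
  have hGinj : ∀ t, Injective fun w : 𝕊 1 ↦ G t w := fun t ↦
    (injective_colMap_add_smul_fst h hp (χ t)).comp Subtype.val_injective
  have hGD : ∀ t (w : 𝕊 1), Injective (fderiv ℝ (G t) w) := by
    intro t w
    rw [show G t = ⇑(colMap (u + χ t • p) v) from rfl, ContinuousLinearMap.fderiv]
    exact injective_colMap_add_smul_fst h hp (χ t)
  have I := SmoothIsotopy.chartCircle p₀ G hGs hGinj hGD
  have hχ0 : χ 0 = 0 := Real.smoothTransition.zero
  have hχ1 : χ 1 = 1 := Real.smoothTransition.one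
  refine ⟨I.copy ?_ ?_⟩
  · funext w
    show (chartAt (𝔼 3) p₀).symm (G 0 w) = _
    congr 1
    show colMap (u + χ 0 • p) v w = colMap u v w
    rw [hχ0, zero_smul, add_zero]
  · funext w
    show (chartAt (𝔼 3) p₀).symm (G 1 w) = _
    congr 1
    show colMap (u + χ 1 • p) v w = colMap (u + p) v w
    rw [hχ1, one_smul]

/-- A smooth path of injective column maps is a smooth isotopy of linear circles (second column
moving). [folklore] -/
theorem isSmoothlyIsotopic_colMap_snd {u v p : 𝔼 3} (h : Injective (colMap u v))
    (hp : p ∉ span ℝ ({u, v} : Set (𝔼 3))) :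
    IsSmoothlyIsotopic (𝓡 1) (𝓡 3) (fun w : 𝕊 1 ↦ (chartAt (𝔼 3) p₀).symm (colMap u v w))
      (fun w : 𝕊 1 ↦ (chartAt (𝔼 3) p₀).symm (colMap u (v + p) w)) := by
  set χ := Real.smoothTransition with hχ_def
  have hχ : ContDiff ℝ ∞ χ := Real.smoothTransition.contDiff
  set G : ℝ → 𝔼 2 → 𝔼 3 := fun t y ↦ colMap u (v + χ t • p) y with hG_def
  have hGs : ∀ t (w : 𝕊 1), ContDiffAt ℝ ∞ (uncurry G) (t, w) := by
    intro t w
    have h0 : ContDiffAt ℝ ∞ (fun q : ℝ × 𝔼 2 ↦ q.2 0) (t, (w : 𝔼 2)) :=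
      ((contDiff_piLp_apply (p := 2) (i := (0 : Fin 2))).comp contDiff_snd).contDiffAt
    have h1 : ContDiffAt ℝ ∞ (fun q : ℝ × 𝔼 2 ↦ q.2 1) (t, (w : 𝔼 2)) :=
      ((contDiff_piLp_apply (p := 2) (i := (1 : Fin 2))).comp contDiff_snd).contDiffAt
    have hχt : ContDiffAt ℝ ∞ (fun q : ℝ × 𝔼 2 ↦ χ q.1) (t, (w : 𝔼 2)) :=
      hχ.contDiffAt.comp _ contDiffAt_fst
    have : uncurry G = fun q : ℝ × 𝔼 2 ↦ q.2 0 • u + q.2 1 • (v + χ q.1 • p) := by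
      funext q; rfl
    rw [this]
    exact (h0.smul contDiffAt_const).add (h1.smul (contDiffAt_const.add (hχt.smul contDiffAt_const)))
  have hGinj : ∀ t, Injective fun w : 𝕊 1 ↦ G t w := fun t ↦
    (injective_colMap_add_smul_snd h hp (χ t)).comp Subtype.val_injective
  have hGD : ∀ t (w : 𝕊 1), Injective (fderiv ℝ (G t) w) := by
    intro t w
    rw [show G t = ⇑(colMap u (v + χ t • p)) from rfl, ContinuousLinearMap.fderiv]
    exact injective_colMap_add_smul_snd h hp (χ t)
  have I := SmoothIsotopy.chartCircle p₀ G hGs hGinj hGD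
  have hχ0 : χ 0 = 0 := Real.smoothTransition.zero
  have hχ1 : χ 1 = 1 := Real.smoothTransition.one
  refine ⟨I.copy ?_ ?_⟩
  · funext w
    show (chartAt (𝔼 3) p₀).symm (G 0 w) = _
    congr 1
    show colMap u (v + χ 0 • p) w = colMap u v w
    rw [hχ0, zero_smul, add_zero]
  · funext w
    show (chartAt (𝔼 3) p₀).symm (G 1 w) = _
    congr 1
    show colMap u (v + χ 1 • p) w = colMap u (v + p) w
    rw [hχ1, one_smul]

/-- The span of two vectors is a proper subspace of `ℝ³`. [folklore] -/
theorem span_pair_ne_top (u v : 𝔼 3) : span ℝ ({u, v} : Set (𝔼 3)) ≠ ⊤ := by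
  classical
  intro h
  have h1 : finrank ℝ (span ℝ ((({u, v} : Finset (𝔼 3)) : Set (𝔼 3)))) ≤ ({u, v} : Finset (𝔼 3)).card :=
    finrank_span_finset_le_card _
  rw [Finset.coe_pair, h, finrank_top, finrank_euclideanSpace_fin] at h1
  linarith [Finset.card_le_two (a := u) (b := v)]

/-- **Generic vectors**: `ℝ³` is not the union of three proper subspaces (a proper subspace is
closed with empty interior). [folklore] -/
theorem exists_not_mem_three {S₁ S₂ S₃ : Submodule ℝ (𝔼 3)} (h₁ : S₁ ≠ ⊤) (h₂ : S₂ ≠ ⊤)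
    (h₃ : S₃ ≠ ⊤) : ∃ x : 𝔼 3, x ∉ S₁ ∧ x ∉ S₂ ∧ x ∉ S₃ := by
  have hint : ∀ {S : Submodule ℝ (𝔼 3)}, S ≠ ⊤ → interior (S : Set (𝔼 3)) = ∅ := fun hS ↦ by
    by_contra hne
    exact hS (Submodule.eq_top_of_nonempty_interior' _ (Set.nonempty_iff_ne_empty.2 hne))
  have hcl : ∀ S : Submodule ℝ (𝔼 3), IsClosed (S : Set (𝔼 3)) := fun S ↦
    S.closed_of_finiteDimensional
  have h12 : interior ((S₁ : Set (𝔼 3)) ∪ S₂) = ∅ := by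
    rw [interior_union_isClosed_of_interior_empty (hcl S₁) (hint h₂), hint h₁]
  have h123 : interior (((S₁ : Set (𝔼 3)) ∪ S₂) ∪ S₃) = ∅ := by
    rw [interior_union_isClosed_of_interior_empty ((hcl S₁).union (hcl S₂)) (hint h₃), h12]
  have hne : ((S₁ : Set (𝔼 3)) ∪ S₂) ∪ S₃ ≠ univ := fun huniv ↦ by
    rw [huniv, interior_univ] at h123
    exact univ_nonempty.ne_empty h123
  obtain ⟨x, hx⟩ := (Set.ne_univ_iff_exists_notMem _).1 hne
  simp only [mem_union, SetLike.mem_coe, not_or] at hx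
  exact ⟨x, hx.1.1, hx.1.2, hx.2⟩

/-- The columns of an injective column map: the first column is nonzero. [folklore] -/
theorem fst_ne_zero_of_injective_colMap {u v : 𝔼 3} (h : Injective (colMap u v)) : u ≠ 0 := by
  intro hu
  have h0 : colMap u v (EuclideanSpace.single 0 1) = 0 := by
    rw [colMap_apply, hu]; simp
  have h1 := (injective_iff_map_eq_zero _).1 h _ h0
  have h2 : (EuclideanSpace.single 0 1 : 𝔼 2) 0 = (0 : 𝔼 2) 0 := by rw [h1]
  simp at h2

/-- The columns of an injective column map: the second column is not a multiple of the first.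
[folklore] -/
theorem snd_ne_smul_of_injective_colMap {u v : 𝔼 3} (h : Injective (colMap u v)) (a : ℝ) :
    v ≠ a • u := by
  intro hv
  have h0 : colMap u v (EuclideanSpace.single 1 1 - a • EuclideanSpace.single 0 1) = 0 := by
    rw [colMap_apply, hv]
    simp [smul_smul]
  have h1 := (injective_iff_map_eq_zero _).1 h _ h0
  have h2 : (EuclideanSpace.single 1 1 - a • EuclideanSpace.single 0 1 : 𝔼 2) 1 = (0 : 𝔼 2) 1 := by
    rw [h1]
  simp at h2

/-- Solving `a • x + b • y = z` for `y` when `b ≠ 0`: `y ∈ span {x, z}`. [folklore] -/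
theorem mem_span_pair_of_eq {x y z : 𝔼 3} {a b : ℝ} (hab : a • x + b • y = z) (hb : b ≠ 0) :
    y ∈ span ℝ ({x, z} : Set (𝔼 3)) := by
  have hy : y = b⁻¹ • (z - a • x) := by
    rw [← hab, add_sub_cancel_left, smul_smul, inv_mul_cancel₀ hb, one_smul]
  rw [hy]
  refine smul_mem _ _ (sub_mem (subset_span (by simp)) (smul_mem _ _ (subset_span (by simp))))

/-- **Any two linear circles in the chart are smoothly isotopic**: the injective column maps
`ℝ² → ℝ³` are connected by four rank-one moves (`isSmoothlyIsotopic_colMap_fst/snd`), the two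
intermediate columns being chosen outside finitely many proper subspaces
(`exists_not_mem_three`). (Hirsch (1976), Ch. 8, proof of Thm. 3.1, joins two linear embeddings
by a path in `GL(n)`; in codimension `≥ 1` no orientation condition arises.) [folklore] -/
theorem isSmoothlyIsotopic_linear {B B' : 𝔼 2 →L[ℝ] 𝔼 3} (hB : Injective B)
    (hB' : Injective B') :
    IsSmoothlyIsotopic (𝓡 1) (𝓡 3) (fun w : 𝕊 1 ↦ (chartAt (𝔼 3) p₀).symm (B w))
      (fun w : 𝕊 1 ↦ (chartAt (𝔼 3) p₀).symm (B' w)) := by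
  rw [eq_colMap B] at hB ⊢
  rw [eq_colMap B'] at hB' ⊢
  set b₁ := B (EuclideanSpace.single 0 1)
  set b₂ := B (EuclideanSpace.single 1 1)
  set b₁' := B' (EuclideanSpace.single 0 1)
  set b₂' := B' (EuclideanSpace.single 1 1)
  -- the two generic columns
  obtain ⟨x, hx1, hx2, -⟩ := exists_not_mem_three (span_pair_ne_top b₁ b₂) (span_pair_ne_top b₁' b₁')
    (span_pair_ne_top b₁' b₁')
  obtain ⟨y, hy1, hy2, hy3⟩ := exists_not_mem_three (span_pair_ne_top x b₂) (span_pair_ne_top x b₁')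
    (span_pair_ne_top b₁' b₂')
  -- move 1: `(b₁, b₂) → (x, b₂)`
  have hp1 : x - b₁ ∉ span ℝ ({b₁, b₂} : Set (𝔼 3)) := fun hmem ↦ hx1 (by
    have := add_mem hmem (subset_span (show b₁ ∈ ({b₁, b₂} : Set (𝔼 3)) by simp))
    rwa [sub_add_cancel] at this)
  have I1 := isSmoothlyIsotopic_colMap_fst p₀ hB hp1
  have hB1 : Injective (colMap x b₂) := by
    have := injective_colMap_add_smul_fst hB hp1 1
    rwa [one_smul, add_sub_cancel] at this
  rw [add_sub_cancel] at I1
  -- move 2: `(x, b₂) → (x, y)`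
  have hp2 : y - b₂ ∉ span ℝ ({x, b₂} : Set (𝔼 3)) := fun hmem ↦ hy1 (by
    have := add_mem hmem (subset_span (show b₂ ∈ ({x, b₂} : Set (𝔼 3)) by simp))
    rwa [sub_add_cancel] at this)
  have I2 := isSmoothlyIsotopic_colMap_snd p₀ hB1 hp2
  have hB2 : Injective (colMap x y) := by
    have := injective_colMap_add_smul_snd hB1 hp2 1
    rwa [one_smul, add_sub_cancel] at this
  rw [add_sub_cancel] at I2
  -- move 3: `(x, y) → (b₁', y)`
  have hp3 : b₁' - x ∉ span ℝ ({x, y} : Set (𝔼 3)) := by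
    intro hmem
    have hb : b₁' ∈ span ℝ ({x, y} : Set (𝔼 3)) := by
      have := add_mem hmem (subset_span (show x ∈ ({x, y} : Set (𝔼 3)) by simp))
      rwa [sub_add_cancel] at this
    obtain ⟨a, b, hab⟩ := mem_span_pair.1 hb
    by_cases hb0 : b = 0
    · rw [hb0, zero_smul, add_zero] at hab
      by_cases ha0 : a = 0
      · rw [ha0, zero_smul] at hab
        exact fst_ne_zero_of_injective_colMap hB' hab.symm
      · apply hx2
        have hx : x = a⁻¹ • b₁' := by rw [← hab, smul_smul, inv_mul_cancel₀ ha0, one_smul]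
        rw [hx]
        exact smul_mem _ _ (subset_span (by simp))
    · exact hy2 (mem_span_pair_of_eq hab hb0)
  have I3 := isSmoothlyIsotopic_colMap_fst p₀ hB2 hp3
  have hB3 : Injective (colMap b₁' y) := by
    have := injective_colMap_add_smul_fst hB2 hp3 1
    rwa [one_smul, add_sub_cancel] at this
  rw [add_sub_cancel] at I3
  -- move 4: `(b₁', y) → (b₁', b₂')`
  have hp4 : b₂' - y ∉ span ℝ ({b₁', y} : Set (𝔼 3)) := by
    intro hmem
    have hb : b₂' ∈ span ℝ ({b₁', y} : Set (𝔼 3)) := by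
      have := add_mem hmem (subset_span (show y ∈ ({b₁', y} : Set (𝔼 3)) by simp))
      rwa [sub_add_cancel] at this
    obtain ⟨a, b, hab⟩ := mem_span_pair.1 hb
    by_cases hb0 : b = 0
    · rw [hb0, zero_smul, add_zero] at hab
      exact snd_ne_smul_of_injective_colMap hB' a hab.symm
    · exact hy3 (mem_span_pair_of_eq hab hb0)
  have I4 := isSmoothlyIsotopic_colMap_snd p₀ hB3 hp4
  rw [add_sub_cancel] at I4
  exact IsSmoothlyIsotopic.trans_holds I1
    (IsSmoothlyIsotopic.trans_holds I2 (IsSmoothlyIsotopic.trans_holds I3 I4))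

end LinearCircles

/-! ## A knot bounding a smoothly embedded disc is the unknot -/

section Unknot

variable [SphereEmbedding.SmoothnessFacts]

/-- **A knot bounding a smoothly embedded disc is trivial.** If `f : 𝔻² → 𝕊³` is a smooth
injective immersion of the closed disc (`C^∞` for the manifold-with-boundary structure of `𝔻²`,
injective, injective differential at every point) whose restriction to the boundary circle is
the knot `K`, then `K` is the unknot: `K` is ambient isotopic to the standard great circle.
Proof: the boundary circle of any such disc is smoothly isotopic, through embeddings
`𝕊¹ → 𝕊³`, to a linear circle `σ⁻¹ ∘ B` in a fixed chart (`exists_isSmoothlyIsotopic_disc_linear`: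
shrink in the disc, linearise in the chart, translate); any two linear circles are smoothly
isotopic (`isSmoothlyIsotopic_linear`); the unknot bounds the hemispherical disc
(`Knot.exists_smoothDisc_unknot`); and a smooth isotopy of embeddings of the compact boundaryless
`𝕊¹` into the closed `𝕊³` is ambient (isotopy extension theorem,
`isAmbientIsotopic_of_isSmoothlyIsotopic_of_boundaryless`, Milnor (1965) Thm. 5.8 / Hirsch (1976)
Ch. 8 Thm. 1.3, proved in `IsotopyExtension.lean`). This is the statement for which Hirsch's
disc theorem (Ch. 8, Thm. 3.1) was vendored as the named fact
`exists_ambientIsotopy_of_smoothDisc_sphereThree`; the present knot-level form follows Hirsch's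
printed proof of Thm. 3.1 (pp. 185–186) for the family of concentric circles of the disc instead
of the disc itself. Cromwell, *Knots and Links* (2004), Ch. 5, p. 103 (a knot spanned by a disc is
trivial). [cite: HirschDT1976, Ch. 8 Thm. 3.1 (proof) and Thm. 1.3] -/
theorem Knot.isUnknot_of_smoothDisc (K : Knot) {f : (𝔻 2) → 𝕊 3}
    (hf : ContMDiff (𝓡∂ 2) (𝓡 3) ∞ f) (hfi : Injective f)
    (hmf : ∀ x, Injective (mfderiv (𝓡∂ 2) (𝓡 3) f x))
    (hbd : ∀ x : 𝕊 1, f ⟨x, sphere_subset_closedBall x.2⟩ = K x) : K.IsUnknot := by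
  set p₀ : 𝕊 3 := f ⟨0, mem_closedBall_zero_iff.2 (by norm_num)⟩ with hp₀_def
  -- the given disc
  obtain ⟨B, hB, h₁⟩ := exists_isSmoothlyIsotopic_disc_linear p₀ hf hfi hmf
  have hK : (fun u : 𝕊 1 ↦ f ⟨u, sphere_subset_closedBall u.2⟩) = ⇑K := funext hbd
  rw [hK] at h₁
  -- the hemispherical disc of the unknot
  obtain ⟨f₀, hf₀, hinj₀, hmf₀, hnorm₀, hbd₀⟩ := Knot.exists_smoothDisc_unknot
  have hmem : ∀ x, f₀ x ∈ 𝕊 3 := fun x ↦ mem_sphere_zero_iff_norm.2 (hnorm₀ x)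
  obtain ⟨B₀, hB₀, h₂⟩ := exists_isSmoothlyIsotopic_disc_linear p₀ (hf₀.codRestrict_sphere hmem)
    (hinj₀.codRestrict hmem) (injective_mfderiv_codRestrict_sphere hf₀ hmf₀ hmem)
  have hU : (fun u : 𝕊 1 ↦ Set.codRestrict f₀ (𝕊 3) hmem ⟨u, sphere_subset_closedBall u.2⟩) =
      ⇑unknot := funext fun u ↦ Subtype.ext (hbd₀ u)
  rw [hU] at h₂
  -- linear circles are connected
  have h₃ := isSmoothlyIsotopic_linear p₀ hB hB₀
  have h : IsSmoothlyIsotopic (𝓡 1) (𝓡 3) ⇑K ⇑unknot :=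
    IsSmoothlyIsotopic.trans_holds h₁ (IsSmoothlyIsotopic.trans_holds h₃ h₂.symm)
  -- isotopy extension
  exact isAmbientIsotopic_of_isSmoothlyIsotopic_of_boundaryless (I := 𝓡 1) (J := 𝓡 3)
    (f := ⇑K) (g := ⇑unknot) h

/-- **A knot is trivial if and only if it bounds a smoothly embedded disc** `𝔻² → 𝕊³` with
boundary parametrisation the knot (`←`: `Knot.isUnknot_of_smoothDisc`; `→`: pull the
hemispherical disc of the unknot back along the final diffeomorphism of an ambient isotopy).
Cromwell (2004), Ch. 5, p. 103; Rolfsen (1976), §1.A. [cite: HirschDT1976, Ch. 8 Thm. 3.1 (proof) and Thm. 1.3] -/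
theorem Knot.isUnknot_iff_exists_smoothDisc (K : Knot) :
    K.IsUnknot ↔ ∃ f : (𝔻 2) → 𝕊 3, ContMDiff (𝓡∂ 2) (𝓡 3) ∞ f ∧ Injective f ∧
      (∀ x, Injective (mfderiv (𝓡∂ 2) (𝓡 3) f x)) ∧
      ∀ x : 𝕊 1, f ⟨x, sphere_subset_closedBall x.2⟩ = K x := by
  refine ⟨fun h ↦ ?_, fun ⟨f, hf, hfi, hmf, hbd⟩ ↦ K.isUnknot_of_smoothDisc hf hfi hmf hbd⟩
  have hn : (∞ : WithTop ℕ∞) ≠ 0 := by simp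
  obtain ⟨F, hF⟩ := h
  obtain ⟨f₀, hf₀, hinj₀, hmf₀, hnorm₀, hbd₀⟩ := Knot.exists_smoothDisc_unknot
  have hmem : ∀ x, f₀ x ∈ 𝕊 3 := fun x ↦ mem_sphere_zero_iff_norm.2 (hnorm₀ x)
  set g₀ := Set.codRestrict f₀ (𝕊 3) hmem with hg₀_def
  set Φ := (F.toDiffeomorph 1).symm with hΦ_def
  refine ⟨Φ ∘ g₀, Φ.contMDiff.comp (hf₀.codRestrict_sphere hmem),
    Φ.injective.comp (hinj₀.codRestrict hmem), fun x ↦ ?_, fun x ↦ ?_⟩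
  · rw [mfderiv_comp x (Φ.contMDiff.mdifferentiableAt hn)
      ((hf₀.codRestrict_sphere hmem).mdifferentiableAt hn)]
    exact (Φ.mfderivToContinuousLinearEquiv hn _).injective.comp
      (injective_mfderiv_codRestrict_sphere hf₀ hmf₀ hmem x)
  · have h1 : g₀ ⟨x, sphere_subset_closedBall x.2⟩ = unknot x := Subtype.ext (hbd₀ x)
    have h2 : unknot x = F.toFun 1 (K x) := (congrFun hF x).symm
    rw [comp_apply, h1, h2]
    exact (F.toDiffeomorph 1).symm_apply_apply (K x)

omit [SphereEmbedding.SmoothnessFacts] in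
/-- **The named fact `Knot.isUnknot_of_hasSeifertSurfaceOfGenus_zero` from the classification of
the disc alone** (proved reduction; the disc theorem leaf `exists_ambientIsotopy_of_smoothDisc_sphereThree`
of `isUnknot_of_hasSeifertSurfaceOfGenus_zero_of` is no longer needed): a genus-`0` Seifert
surface is reparametrised as a smooth disc `𝔻² → 𝕊³` bounding `K`
(`HasSeifertSurfaceOfGenus.exists_smoothDisc_of_facts`, from `diffeomorph_closedBall_of_genus_zero`,
Hirsch (1976) Ch. 9 Thm. 3.7), and a knot bounding a smooth disc is trivial
(`Knot.isUnknot_of_smoothDisc`). Cromwell (2004), Ch. 5, p. 103.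
[cite: Cromwell2004, Ch. 5 p. 103] [cite: HirschDT1976, Ch. 9 Thm. 3.7] -/
theorem Knot.isUnknot_of_hasSeifertSurfaceOfGenus_zero_of_classification
    (hC : diffeomorph_closedBall_of_genus_zero) : isUnknot_of_hasSeifertSurfaceOfGenus_zero := by
  intro _ K hK
  obtain ⟨f, hf, hinj, hmf, hnorm, hbd⟩ := hK.exists_smoothDisc_of_facts hC
  have hmem : ∀ x, f x ∈ 𝕊 3 := fun x ↦ mem_sphere_zero_iff_norm.2 (hnorm x)
  exact K.isUnknot_of_smoothDisc (hf.codRestrict_sphere hmem) (hinj.codRestrict hmem)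
    (injective_mfderiv_codRestrict_sphere hf hmf hmem) fun x ↦ Subtype.ext (hbd x)

omit [SphereEmbedding.SmoothnessFacts] in
/-- **`genus 0 ↔ unknot` from Seifert's theorem and the classification of the disc** (proved
reduction of `Knot.genus_eq_zero_iff_isUnknot`, `SliceGenus.lean`). [cite: Cromwell2004, Ch. 5 p. 103] -/
theorem Knot.genus_eq_zero_iff_isUnknot_of_classification (hS : exists_hasSeifertSurfaceOfGenus)
    (hC : diffeomorph_closedBall_of_genus_zero) : genus_eq_zero_iff_isUnknot :=
  genus_eq_zero_iff_isUnknot_of hS (isUnknot_of_hasSeifertSurfaceOfGenus_zero_of_classification hC)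

/-- **Property R two standard theorems down** (proved reduction of `spc4.S25`,
`Literature.Topology.FourManifolds.isUnknot_of_isIntegralSurgery_zero`): Gabai (1987), Cor. 8.3
(genus clause, the named fact `Knot.hasSeifertSurfaceOfGenus_le_of_isIntegralSurgery_zero`:
if `M` is `0`-surgery on `K` then every nonseparating closed orientable surface in `M` has genus
`≥ genus K`; for `M = S² × S¹` the sphere `S² × {p}` gives genus `0`, Gabai's Remark 8.5, p. 526)
and the classification fact `diffeomorph_closedBall_of_genus_zero` (a compact connected
orientable surface with one boundary circle and `H₁ = 0` is a disc; Hirsch (1976), Ch. 9,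
Thm. 3.7) imply Property R: if `S² × S¹` is `0`-surgery on `K ⊆ S³` then `K` is the unknot. The
third leaf of `isUnknot_of_isIntegralSurgery_zero_of_gabai_of_hirsch` (Hirsch's disc theorem in
`𝕊³`) is discharged by `Knot.isUnknot_of_smoothDisc`.
[cite: GabaiJDG1987, Cor. 8.3 and Remark 8.5] -/
theorem isUnknot_of_isIntegralSurgery_zero_of_gabai_of_classification
    (h83 : Knot.hasSeifertSurfaceOfGenus_le_of_isIntegralSurgery_zero.{0})
    (hC : diffeomorph_closedBall_of_genus_zero) : isUnknot_of_isIntegralSurgery_zero :=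
  isUnknot_of_isIntegralSurgery_zero_of_gabai_of_disc h83
    (Knot.isUnknot_of_hasSeifertSurfaceOfGenus_zero_of_classification hC)

end Unknot

end Literature.Topology.FourManifolds
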